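import Summits.Parity.GeneralizedHardyLittlewood.Theses.EntropyRate
import Summits.Parity.GeneralizedHardyLittlewood.Theorems.LiouvilleShiftedTablesPairsHLOdd
import Summits.Parity.GeneralizedHardyLittlewood.Theorems.EngineToPairs.Negative.EngineToPairsShiftBoundary

/-!
# `FixedShiftLiouvilleLaw` (stmt-Parity-17877): the odd shifts are natural-density Chowla

Structural / negative-side lemmas for the crux `EntropyRate.FixedShiftLiouvilleLaw`
(`∀ h ≥ 1, ∃ c ≠ 0, ∑_{n≤N} Λ(n)Λ(n+h) − 𝔖({0,h})·N − c·∑_{n≤N} λ(n)λ(n+h) = o(N)`) of route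
`EntropyRate` (Parity / GeneralizedHardyLittlewood), landed from the birth crux-attack (refuter seat)
so that planners, ideators and provers can IMPORT them.

* §1 `law_iff_chowla_of_odd` — at an ODD shift `h` the Hardy–Littlewood part is unconditionally
  `o(N)` (tree: `Theorems.PairsHL.pairsHL_odd`: `𝔖({0,h}) = 0` and `∑ Λ(n)Λ(n+h) ≪ log³ N`, the sum
  being supported on powers of two), so the law at `h` — BECAUSE it insists on `c ≠ 0` — is
  EQUIVALENT to natural-density binary Chowla at `h`, `∑_{n≤N} λ(n)λ(n+h) = o(N)`. Hence
  `chowla_one_of_fixedShiftLiouvilleLaw`: the crux as filed contains the natural-density binary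
  Chowla conjecture at `h = 1` (the classical open conjecture; Tao 2016 is logarithmic, Tao–Teräväinen
  2019 almost-all-scales), independently of the route's door `UniformEntropyRate`.
* §2 `fixedShiftLiouvilleLaw_iff_even_and_chowlaOdd` — the crux splits as
  (its restriction to EVEN shifts) ∧ (natural Chowla at every ODD shift). The even-shift restriction is
  the intended content (the "Hardy–Littlewood error IS a multiple of the Chowla sum" law only has
  content where `𝔖({0,h}) ≠ 0`); the odd half is dead weight for the route's `closes`, whose `PairsHL`
  at odd shifts is the tree theorem `pairsHL_odd` / `pairsHL_iff_even`.
* §3 `fixedShiftLiouvilleLaw_iff_pairsHL_of_chowlaFixed` — modulo the route's own node `ChowlaFixed`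
  the crux is EQUIVALENT to the target `PairsHL` (so, given the door's output, it is exactly as hard as
  Hardy–Littlewood pairs; conversely it holds with every `c` in a world with HL ∧ Chowla, so the
  advertised witness constant has no checkable content at the `o(N)` scale there).

* §4 `law_false_at_zero`, `fixedShiftLiouvilleLaw_false_without_shiftPos` — the clause `1 ≤ h` is
  load-bearing: at `h = 0` the Chowla sum is `∑ λ(n)² = N` and `𝔖({0,0}) = 1`, while
  `∑_{n≤N} Λ(n)² ≥ N log N / 8` (tree: `EngineToPairs.Negative.sum_vonMangoldt_sq_ge`), so for EVERY
  real `c` the law fails at the excluded shift.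

No unconditional refutation follows (and none is claimed): by §2, `¬ FixedShiftLiouvilleLaw` is
(natural Chowla fails at some odd shift) ∨ (at some even shift no `c ≠ 0` aligns the Hardy–Littlewood
error with the Chowla sum) — both open. [folklore]
-/

open Finset Filter Asymptotics ArithmeticFunction

noncomputable section

namespace Summit.Parity.GeneralizedHardyLittlewood.Theorems.FixedShiftLiouvilleLaw.Negative

open Literature.NumberTheory.Sieve
open Summit.Parity.GeneralizedHardyLittlewood.Theses.EntropyRate

/-! ## §1 Odd shifts: the law is natural-density Chowla -/

/-- **Odd shifts.** For odd `h`, `∑_{n≤N} Λ(n)Λ(n+h) − 𝔖({0,h})N = o(N)` unconditionally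
(`PairsHL.pairsHL_odd`), so `∃ c ≠ 0, HL-error − c·(Chowla sum) = o(N)` holds iff the Chowla sum
itself is `o(N)`. [folklore] -/
theorem law_iff_chowla_of_odd {h : ℕ} (hh : Odd h) :
    (∃ c : ℝ, c ≠ 0 ∧ (fun N : ℕ => ∑ n ∈ Finset.Icc 1 N, ArithmeticFunction.vonMangoldt n *
        ArithmeticFunction.vonMangoldt (n + h)
        - Literature.NumberTheory.Sieve.singularSeries ({0, (h : ℤ)} : Finset ℤ) * N
        - c * ∑ n ∈ Finset.Icc 1 N, (((ArithmeticFunction.liouville n *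
            ArithmeticFunction.liouville (n + h) : ℤ)) : ℝ)) =o[Filter.atTop] fun N : ℕ => (N : ℝ))
    ↔ (fun N : ℕ => ∑ n ∈ Finset.Icc 1 N, (((ArithmeticFunction.liouville n *
          ArithmeticFunction.liouville (n + h) : ℤ)) : ℝ)) =o[Filter.atTop] fun N : ℕ => (N : ℝ) := by
  have hP := PairsHL.pairsHL_odd hh
  constructor
  · rintro ⟨c, hc, hlaw⟩
    have h1 := hP.sub hlaw
    have h2 : (fun N : ℕ => c * ∑ n ∈ Finset.Icc 1 N, (((ArithmeticFunction.liouville n *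
        ArithmeticFunction.liouville (n + h) : ℤ)) : ℝ)) =o[Filter.atTop] fun N : ℕ => (N : ℝ) := by
      refine h1.congr' (Eventually.of_forall fun N => ?_) EventuallyEq.rfl
      ring
    refine (h2.const_mul_left c⁻¹).congr' (Eventually.of_forall fun N => ?_) EventuallyEq.rfl
    exact inv_mul_cancel_left₀ hc _
  · intro hC
    refine ⟨1, one_ne_zero, ?_⟩
    refine (hP.sub (hC.const_mul_left 1)).congr' (Eventually.of_forall fun N => ?_) EventuallyEq.rfl
    ring

/-- **The crux contains natural Chowla at every odd shift.** [folklore] -/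
theorem chowla_odd_of_fixedShiftLiouvilleLaw (hL : FixedShiftLiouvilleLaw) {h : ℕ} (hh : Odd h)
    (h1 : 1 ≤ h) :
    (fun N : ℕ => ∑ n ∈ Finset.Icc 1 N, (((ArithmeticFunction.liouville n *
        ArithmeticFunction.liouville (n + h) : ℤ)) : ℝ)) =o[Filter.atTop] fun N : ℕ => (N : ℝ) :=
  (law_iff_chowla_of_odd hh).mp (hL h h1)

/-- **In particular `h = 1`:** `FixedShiftLiouvilleLaw` implies the natural-density binary Chowla
conjecture `∑_{n≤N} λ(n)λ(n+1) = o(N)` (open). [folklore] -/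
theorem chowla_one_of_fixedShiftLiouvilleLaw (hL : FixedShiftLiouvilleLaw) :
    (fun N : ℕ => ∑ n ∈ Finset.Icc 1 N, (((ArithmeticFunction.liouville n *
        ArithmeticFunction.liouville (n + 1) : ℤ)) : ℝ)) =o[Filter.atTop] fun N : ℕ => (N : ℝ) :=
  chowla_odd_of_fixedShiftLiouvilleLaw hL odd_one le_rfl

/-! ## §2 The split: even-shift law ∧ odd-shift Chowla -/

/-- **Decomposition of the crux.** `FixedShiftLiouvilleLaw` ↔ (the law at EVEN shifts `h ≥ 1`) ∧
(natural-density Chowla at every ODD shift `h ≥ 1`). The first conjunct is the intended statement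
(repair: add the side condition `Even h`); the second is what the missing side condition costs.
[folklore] -/
theorem fixedShiftLiouvilleLaw_iff_even_and_chowlaOdd :
    FixedShiftLiouvilleLaw ↔
      (∀ h : ℕ, 1 ≤ h → Even h → ∃ c : ℝ, c ≠ 0 ∧ (fun N : ℕ => ∑ n ∈ Finset.Icc 1 N,
          ArithmeticFunction.vonMangoldt n * ArithmeticFunction.vonMangoldt (n + h)
          - Literature.NumberTheory.Sieve.singularSeries ({0, (h : ℤ)} : Finset ℤ) * N
          - c * ∑ n ∈ Finset.Icc 1 N, (((ArithmeticFunction.liouville n *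
              ArithmeticFunction.liouville (n + h) : ℤ)) : ℝ)) =o[Filter.atTop] fun N : ℕ => (N : ℝ)) ∧
      (∀ h : ℕ, 1 ≤ h → Odd h → (fun N : ℕ => ∑ n ∈ Finset.Icc 1 N,
          (((ArithmeticFunction.liouville n * ArithmeticFunction.liouville (n + h) : ℤ)) : ℝ))
            =o[Filter.atTop] fun N : ℕ => (N : ℝ)) := by
  constructor
  · intro hL
    exact ⟨fun h h1 _ => hL h h1, fun h h1 hh => (law_iff_chowla_of_odd hh).mp (hL h h1)⟩
  · rintro ⟨hE, hO⟩ h h1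
    rcases Nat.even_or_odd h with he | ho
    · exact hE h h1 he
    · exact (law_iff_chowla_of_odd ho).mpr (hO h h1 ho)

/-! ## §3 Modulo the node `ChowlaFixed`, the crux is the target `PairsHL` -/

/-- **Modulo natural Chowla the crux is Hardy–Littlewood pairs.** Given `ChowlaFixed`
(`∑_{n≤N} λ(n)λ(n+h) = o(N)` for every `h ≥ 1`), `FixedShiftLiouvilleLaw ↔ PairsHL`: the term
`c·(Chowla sum)` is `o(N)` for every `c`, so the law says exactly that the Hardy–Littlewood error is
`o(N)` (and then holds with every constant, e.g. `c = 1`). [folklore] -/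
theorem fixedShiftLiouvilleLaw_iff_pairsHL_of_chowlaFixed (hC : ChowlaFixed) :
    FixedShiftLiouvilleLaw ↔ PairsHL := by
  constructor
  · intro hL h hh
    obtain ⟨c, -, hc⟩ := hL h hh
    refine (hc.add ((hC h hh).const_mul_left c)).congr' (Eventually.of_forall fun N => ?_)
      EventuallyEq.rfl
    ring
  · intro hP h hh
    refine ⟨1, one_ne_zero, ?_⟩
    refine ((hP h hh).sub ((hC h hh).const_mul_left 1)).congr' (Eventually.of_forall fun N => ?_)
      EventuallyEq.rfl
    ring

/-! ## §4 The excluded shift `h = 0`: the clause `1 ≤ h` is load-bearing -/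

/-- At shift `0` the Chowla sum is `∑_{n≤N} λ(n)² = N`. [folklore] -/
theorem chowlaSum_zero (N : ℕ) :
    ∑ n ∈ Finset.Icc 1 N, (((ArithmeticFunction.liouville n *
        ArithmeticFunction.liouville (n + 0) : ℤ)) : ℝ) = N := by
  have hterm : ∀ n ∈ Finset.Icc 1 N, (((ArithmeticFunction.liouville n *
      ArithmeticFunction.liouville (n + 0) : ℤ)) : ℝ) = 1 := by
    intro n hn
    have hn0 : n ≠ 0 := by have := (Finset.mem_Icc.mp hn).1; omega
    rw [add_zero, ArithmeticFunction.liouville_apply hn0, ← pow_add, ← two_mul, pow_mul]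
    simp
  rw [Finset.sum_congr rfl hterm, Finset.sum_const, nsmul_eq_mul, mul_one, Nat.card_Icc,
    Nat.add_sub_cancel]

/-- **The shift `0` is excluded for cause.** At `h = 0` the law reads
`∑_{n≤N} Λ(n)² − N − c·N = o(N)`, false for EVERY real `c` since `∑_{n≤N} Λ(n)² ≥ N log N / 8`
for `N ≥ 2²⁴`. [folklore] -/
theorem law_false_at_zero (c : ℝ) :
    ¬ ((fun N : ℕ => ∑ n ∈ Finset.Icc 1 N, ArithmeticFunction.vonMangoldt n *
        ArithmeticFunction.vonMangoldt (n + 0)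
        - Literature.NumberTheory.Sieve.singularSeries ({0, ((0 : ℕ) : ℤ)} : Finset ℤ) * N
        - c * ∑ n ∈ Finset.Icc 1 N, (((ArithmeticFunction.liouville n *
            ArithmeticFunction.liouville (n + 0) : ℤ)) : ℝ)) =o[Filter.atTop] fun N : ℕ => (N : ℝ)) := by
  intro hlaw
  rw [EngineToPairs.Negative.singularSeries_pair_zero] at hlaw
  have hev := hlaw.def one_pos
  have hlog : Tendsto (fun N : ℕ => Real.log N) atTop atTop :=
    Real.tendsto_log_atTop.comp tendsto_natCast_atTop_atTop
  obtain ⟨N, hb, hN, hlogN⟩ :=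
    (hev.and ((eventually_ge_atTop (2 ^ 24)).and (hlog.eventually_ge_atTop (8 * (3 + |c|))))).exists
  have hlow := EngineToPairs.Negative.sum_vonMangoldt_sq_ge hN
  have hN0 : (0 : ℝ) < N := by exact_mod_cast (lt_of_lt_of_le (by norm_num) hN)
  rw [chowlaSum_zero N, one_mul, one_mul, Real.norm_eq_abs, Real.norm_of_nonneg hN0.le] at hb
  have hup := (abs_le.mp hb).2
  have h1 : (N : ℝ) * Real.log N / 8 ≤ (2 + |c|) * N := by
    have hc : c * (N : ℝ) ≤ |c| * N := by gcongr; exact le_abs_self c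
    nlinarith
  have h2 : Real.log N / 8 ≤ 2 + |c| := by
    refine le_of_mul_le_mul_left ?_ hN0
    linarith
  linarith

/-- **`1 ≤ h` is load-bearing:** the law cannot be asked at every shift `h : ℕ`. [folklore] -/
theorem fixedShiftLiouvilleLaw_false_without_shiftPos :
    ¬ ∀ h : ℕ, ∃ c : ℝ, c ≠ 0 ∧ (fun N : ℕ => ∑ n ∈ Finset.Icc 1 N,
        ArithmeticFunction.vonMangoldt n * ArithmeticFunction.vonMangoldt (n + h)
        - Literature.NumberTheory.Sieve.singularSeries ({0, (h : ℤ)} : Finset ℤ) * N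
        - c * ∑ n ∈ Finset.Icc 1 N, (((ArithmeticFunction.liouville n *
            ArithmeticFunction.liouville (n + h) : ℤ)) : ℝ)) =o[Filter.atTop] fun N : ℕ => (N : ℝ) := by
  intro H
  obtain ⟨c, -, hc⟩ := H 0
  exact law_false_at_zero c hc

end Summit.Parity.GeneralizedHardyLittlewood.Theorems.FixedShiftLiouvilleLaw.Negative

end
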